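import Summits.Ventures.YMGap.BEDoor.SU2
import HarnessLib

/-!
# The Bakry–Émery strong-coupling door for `SU(2)`, `d = 4`, RE-EXPORTED BY NAME on the QuantumFields side (ladder LADDER-YM rung R2d «door»)

Cell `ym-beyond`, seat P4 (g15), answering director-ym LINE №10 (a) option (i): a route file of summit `QuantumFields`
may not import `Summits.Ventures.YMGap.*`, so the door theorem `Summit.Ventures.YMGap.BEDoor.su2_clustersWith_numeric`
(module `BEDoor/SU2.lean` of the cell's LIFT v8.3) is made citable from the YangMills tree by this Theorems-side file: ONE closed
`Prop` `DoorBE_SU2` whose text is that theorem's statement verbatim (universally closed over the torus side `L`, the perturbation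
`W`, the strip norm `η` and the tree coupling `β`), and its proof `doorBE_SU2_holds` BY NAME.  A spine route (e.g.
`Theses/BalabanLadder.lean`) can then carry the door as an `aside`/support item `… := DoorBE_SU2` through the allow-listed import of
its own summit's `Theorems`, and the ladder can list the YangMills FQN.

WHAT THIS IS (strong-coupling BANK of THE NUMBER, HOME/THE-NUMBER.md): finite-lattice exponential clustering, in P2's output currency
`RobustBall.ClustersWith W β A (1/100)`, of the `SU(2)` lattice gauge measure on the four-torus `(ℤ/L)⁴` perturbed by any quasi-local
gauge-invariant activity `W` whose analytic strip norm (P2's input predicate `HasAnalyticNormLE … stripDomain … 1`) is `≤ η` and whose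
supports are thin, whenever `81/5·|β| + 22/5·η < 1`.
WHAT THIS IS NOT: not clustering at weak coupling, not a statement at large `β`, not uniform in anything but the volume, NOT the mass
gap, not a rung by itself — the R2d BRIDGE is `Y2Bridge.yangMills_of_legs` (Theorems/Y2BridgeClay.lean) and is closed as typed; this
door is enclosure on the strong side only («the two windows do not meet»).  No conjecture name, no `sorry`, standard axioms only.
References: H. Shen, R. Zhu, X. Zhu, CMP 400 (2023) 805 (arXiv:2204.12737) Thm 1.2; D. Bakry, M. Émery, LNM 1123 (1985);
T. Bałaban, CMP 109 (1987) 249, (1.18)–(1.22) (analyticity format). [folklore]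

FILING NOTE (courier seat `ym-beyond-courier`, prover filing rights D-0016; payload `p4-g15-files/StrongCouplingDoorBE.lean` sha16
748ed1f7a0b49b53 of seat P4 g15; no mathematics added, no statement changed): the only courier delta is the removal of the `[folklore]`
token from the docstring of the PROVED closed `Prop` `DoorBE_SU2` — with the tag the gate's inline-fact relocation split the def out to
`Literature/Uncategorized/` as a named fact and bounced it (p416092/p416134); `DoorBE_SU2` is a re-export proved in this file, not a
Literature fact.
-/

namespace Summit.QuantumFields.YangMills.Theorems.StrongCouplingDoorBE

open Literature.MathematicalPhysics.QuantumFieldTheory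
open Literature.MathematicalPhysics.QuantumLattice (fundamentalRep)
open Summit.Ventures.YMGap Summit.Ventures.YMGap.SharpClustering

/-- **The Bakry–Émery door, `SU(2)`, `d = 4`** as one closed `Prop`: for every torus side `L > 1`, every quasi-local perturbation
`W` of the `SU(2)` Wilson weight with analytic strip norm `≤ η` on P2's strip of radius `1` (amplitude `1`) and thin supports
(`diam X ≤ |X| − 1` on its support), and every tree coupling `β` with `81/5·|β| + 22/5·η < 1`, the perturbed measure clusters
exponentially at rate `1/100` with amplitude `(1 − 81/5·|β| − 22/5·η)⁻¹`, volume-uniformly (`RobustBall.ClustersWith`).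
Statement = `Summit.Ventures.YMGap.BEDoor.su2_clustersWith_numeric` verbatim, closed over its variables.  (PROVED below by
`doorBE_SU2_holds`; deliberately carries no provenance tag — courier filing note in the module docstring.) -/
def DoorBE_SU2 : Prop :=
  ∀ (L : ℕ) [NeZero L], 1 < L → ∀ (W : RobustBall.Perturbation 4 L 2) (η β : ℝ),
    W.HasAnalyticNormLE (fundamentalRep (Fin 2)) (fun _ => stripDomain (d := 4) (L := L) (fundamentalRep (Fin 2)) 1) 1 η →
    (∀ X, W.act X ≠ 0 → (RobustBall.polymerDiam X : ℝ) ≤ (X.card : ℝ) - 1) →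
    81 / 5 * |β| + 22 / 5 * η < 1 →
    RobustBall.ClustersWith W β (1 / (1 - (81 / 5 * |β| + 22 / 5 * η))) (1 / 100)

/-- The door holds: by NAME from the Ventures-side theorem `BEDoor.su2_clustersWith_numeric` (LIFT v8.3 module 11). [folklore] -/
theorem doorBE_SU2_holds : DoorBE_SU2 :=
  fun _L _ hL W _η β hW hsupp hdoor => BEDoor.su2_clustersWith_numeric hL W β hW hsupp hdoor

end Summit.QuantumFields.YangMills.Theorems.StrongCouplingDoorBE
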